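import Summits.KontsevichZagierPeriods.KontsevichZagierPeriods.Theorems.RootDecompWalshStrataEulerDescent09

/-!
# Conic descent, gen 6 (L4 one-variable Euler descent `[T, R(x)·√(ex²+fx+g)^{±1}] ∈ InBaker`), part 10/12

Declarations `moebius_mirror_eq` … `InBaker.euler_full` of the farm-checked gen-6 monolith; see the module docstring of
`EulerDescent01` (part 1) for the overview, the design and the sources. [KontsevichZagier2001 §1.1–1.2; BCR1998 §2.2; Euler 1768; this node gen 4 `sqrtDescent_*`]
-/

noncomputable section

open Literature.NumberTheory.Transcendental
open MeasureTheory Set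
open MvPolynomial (aeval)
open Literature.ModelTheory.ExponentialFields (IsSemialgebraic isSemialgebraic_univ
  isSemialgebraic_setOf_eval_pos isSemialgebraic_setOf_eval_lt isSemialgebraic_setOf_eval_le
  isSemialgebraic_setOf_eval_nonneg isSemialgebraic_setOf_eval_eq_zero continuous_aeval_real
  tarski_seidenberg_real_holds)

namespace Summit.KontsevichZagierPeriods.RootDecompWalshStrata.ConicDescent

/-- The `μ_∞`-mirror `z ↦ 2z̃₀ − z` of the inverted conic `D̃` (`z̃₀ = −D′(a)/(2D(a))`), read in
the coordinate `x = a + 1/z`, is the involution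
`μ_a(x) = (a²(ex + f) + 2ga − gx)/(−ea² + 2eax + fx + g)` (wherever defined; `D(a) ≠ 0`).
[this node] -/
theorem moebius_mirror_eq (e f g a x : ℝ) (hxa : x ≠ a) (hDa : e * a ^ 2 + f * a + g ≠ 0)
    (hden : -e * a ^ 2 + 2 * e * a * x + f * x + g ≠ 0) :
    a + (2 * (-(2 * e * a + f) / (2 * (e * a ^ 2 + f * a + g))) - (x - a)⁻¹)⁻¹ =
      (a ^ 2 * (e * x + f) + 2 * g * a - g * x) / (-e * a ^ 2 + 2 * e * a * x + f * x + g) := by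
  have hxa' : x - a ≠ 0 := sub_ne_zero.2 hxa
  obtain ⟨Da, hDadef⟩ : ∃ Da : ℝ, Da = e * a ^ 2 + f * a + g := ⟨_, rfl⟩
  obtain ⟨W, hWdef⟩ : ∃ W : ℝ, W = -e * a ^ 2 + 2 * e * a * x + f * x + g := ⟨_, rfl⟩
  rw [← hDadef] at hDa ⊢
  rw [← hWdef] at hden ⊢
  have hw : 2 * (-(2 * e * a + f) / (2 * Da)) - (x - a)⁻¹ = -W / (Da * (x - a)) := by
    rw [eq_div_iff (mul_ne_zero hDa hxa')]
    field_simp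
    subst hDadef hWdef
    ring
  rw [hw, inv_div, eq_div_iff hden]
  field_simp
  subst hDadef hWdef
  ring

/-- At a root `θ` of `D`, `μ_a(θ) = θ′ = −f/e − θ` (the other root) for EVERY centre `a ≠ θ`: the
one configuration no inversion can dodge is a pole of `R` at the conjugate root of `D`, i.e. a
factor `D` of the denominator — which `InBaker.inv_sqrt_factor` treats. [this node] -/
theorem moebius_mirror_root (e f g a θ : ℝ) (he : e ≠ 0) (hθa : θ ≠ a)
    (hD : e * θ ^ 2 + f * θ + g = 0) :
    (a ^ 2 * (e * θ + f) + 2 * g * a - g * θ) / (-e * a ^ 2 + 2 * e * a * θ + f * θ + g) =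
      -f / e - θ := by
  have hg : g = -e * θ ^ 2 - f * θ := by linear_combination hD
  subst hg
  have h1 : (a - θ) ^ 2 ≠ 0 := pow_ne_zero 2 (sub_ne_zero.2 (Ne.symm hθa))
  have hd : -e * a ^ 2 + 2 * e * a * θ + f * θ + (-e * θ ^ 2 - f * θ) = -e * (a - θ) ^ 2 := by
    ring
  rw [hd, div_eq_iff (mul_ne_zero (neg_ne_zero.2 he) h1)]
  field_simp
  ring

/-- The `z̃`-mirror abscissa `w = 2z̃₀ − 1/(x − a)` in closed form. [this node] -/
theorem moebius_w_eq (e f g a x : ℝ) (hxa : x ≠ a) (hDa : e * a ^ 2 + f * a + g ≠ 0) :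
    2 * (-(2 * e * a + f) / (2 * (e * a ^ 2 + f * a + g))) - (x - a)⁻¹ =
      -(-e * a ^ 2 + 2 * e * a * x + f * x + g) / ((e * a ^ 2 + f * a + g) * (x - a)) := by
  have hxa' : x - a ≠ 0 := sub_ne_zero.2 hxa
  obtain ⟨Da, hDadef⟩ : ∃ Da : ℝ, Da = e * a ^ 2 + f * a + g := ⟨_, rfl⟩
  obtain ⟨W, hWdef⟩ : ∃ W : ℝ, W = -e * a ^ 2 + 2 * e * a * x + f * x + g := ⟨_, rfl⟩
  rw [← hDadef] at hDa ⊢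
  rw [← hWdef, eq_div_iff (mul_ne_zero hDa hxa')]
  field_simp
  subst hDadef hWdef
  ring

/-! #### 24.16 Generic inversion centres exist -/

/-- **GENERIC CENTRES.** If no real root of `Q₀` is a root of `D` (e.g. `Q₀` coprime to `D` and
without rational roots), then for every real point `x⋆` and every rational `lo ≤ x⋆` some centre
`a ∈ ℚ`, `a < lo`, is GOOD at `x⋆`: either `D(a) = 0` (linear radicand after inversion, no mirror
condition) or the reversed Taylor denominator `Qt = reflect (deg Q₀) (taylor a Q₀)` does not
vanish at the `z̃`-mirror `2z̃₀ − z⋆` of `z⋆ = 1/(x⋆ − a)`.  Proof: a bad centre solves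
`μ_a(x⋆) = ρ` for a real root `ρ` of `Q₀` — a quadratic equation in `a` that is trivial only if
`D(ρ) = 0` — so the bad centres form a finite set, and `lo − 1 − k`, `k = 0, …, #bad`, cannot all
be bad.  (With continuity and compactness of the hull this is the dispatcher of the FULL Euler
descent; see the node.) [this node] -/
theorem exists_moebius_centre (e f g : ℚ) (Q₀ : Polynomial ℚ) (hQ₀ : Q₀ ≠ 0)
    (hQD : ∀ ρ : ℝ, Polynomial.aeval ρ Q₀ = 0 → qD e f g ρ ≠ 0) (xs : ℝ) (lo : ℚ)
    (hlo : (lo : ℝ) ≤ xs) :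
    ∃ a : ℚ, a < lo ∧ (e * a ^ 2 + f * a + g ≠ 0 →
      Polynomial.aeval (2 * ((-(2 * e * a + f) / (2 * (e * a ^ 2 + f * a + g)) : ℚ) : ℝ) -
        (xs - a)⁻¹) (Polynomial.reflect Q₀.natDegree (Polynomial.taylor a Q₀)) ≠ 0) := by
  classical
  -- the real roots of `Q₀`
  obtain ⟨S, hS⟩ : ∃ S : Finset ℝ, ∀ ρ : ℝ, Polynomial.aeval ρ Q₀ = 0 → ρ ∈ S := by
    refine ⟨(Q₀.map (algebraMap ℚ ℝ)).roots.toFinset, fun ρ hρ => ?_⟩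
    rw [Multiset.mem_toFinset, Polynomial.mem_roots
      ((Polynomial.map_ne_zero_iff (algebraMap ℚ ℝ).injective).2 hQ₀), Polynomial.IsRoot.def,
      Polynomial.eval_map, ← Polynomial.aeval_def]
    exact hρ
  -- for each root `ρ`, the quadratic equation `μ_a(x⋆) = ρ` in the centre `a`
  set P : ℝ → Polynomial ℝ := fun ρ =>
    Polynomial.C ((e : ℝ) * xs + f + e * ρ) * Polynomial.X ^ 2 +
      Polynomial.C (2 * (g : ℝ) - 2 * e * ρ * xs) * Polynomial.X +
      Polynomial.C (-(g : ℝ) * xs - ρ * f * xs - ρ * g) with hPdef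
  have hPeval : ∀ ρ t : ℝ, (P ρ).eval t =
      ((e : ℝ) * xs + f + e * ρ) * t ^ 2 + (2 * (g : ℝ) - 2 * e * ρ * xs) * t +
        (-(g : ℝ) * xs - ρ * f * xs - ρ * g) := fun ρ t => by
    simp only [hPdef, Polynomial.eval_add, Polynomial.eval_mul, Polynomial.eval_C,
      Polynomial.eval_pow, Polynomial.eval_X]
  -- … which is non-trivial at a root of `Q₀` (else `D(ρ) = 0`)
  have hPne : ∀ ρ : ℝ, Polynomial.aeval ρ Q₀ = 0 → P ρ ≠ 0 := by
    intro ρ hρ hP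
    have h0 := hPeval ρ 0
    have h1 := hPeval ρ 1
    have h2 := hPeval ρ (-1)
    rw [hP, Polynomial.eval_zero] at h0 h1 h2
    have hu : (e : ℝ) * xs + f + e * ρ = 0 := by linarith
    have hv : 2 * (g : ℝ) - 2 * e * ρ * xs = 0 := by linarith
    apply hQD ρ hρ
    simp only [qD]
    linear_combination ρ * hu + (1 / 2 : ℝ) * hv
  -- the finite set of bad centres
  set B : Finset ℝ := S.biUnion fun ρ => (P ρ).roots.toFinset with hBdef
  have hbad : ∀ a : ℚ, a < lo → e * a ^ 2 + f * a + g ≠ 0 →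
      Polynomial.aeval (2 * ((-(2 * e * a + f) / (2 * (e * a ^ 2 + f * a + g)) : ℚ) : ℝ) -
        (xs - a)⁻¹) (Polynomial.reflect Q₀.natDegree (Polynomial.taylor a Q₀)) = 0 →
      (a : ℝ) ∈ B := by
    intro a ha hDa hzero
    have ha' : (a : ℝ) < lo := by exact_mod_cast ha
    have hxa : xs ≠ a := by intro h; linarith
    have hDa' : (e : ℝ) * a ^ 2 + f * a + g ≠ 0 := by exact_mod_cast hDa
    set w : ℝ := 2 * ((-(2 * e * a + f) / (2 * (e * a ^ 2 + f * a + g)) : ℚ) : ℝ) - (xs - a)⁻¹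
      with hwdef
    -- `w ≠ 0`: at `0` the reversed Taylor polynomial takes the value `lead Q₀ ≠ 0`
    have hw0 : w ≠ 0 := by
      intro hw0
      rw [hw0, Polynomial.aeval_def, Polynomial.eval₂_at_zero, Polynomial.coeff_zero_eq_eval_zero,
        eval_zero_revTaylor] at hzero
      exact Polynomial.leadingCoeff_ne_zero.2 hQ₀
        ((algebraMap ℚ ℝ).injective (hzero.trans (map_zero _).symm))
    -- the point `ρ = a + 1/w = μ_a(x⋆)` is a root of `Q₀`
    set ρ : ℝ := (a : ℝ) + w⁻¹ with hρdef
    have hρa : ρ ≠ a := by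
      rw [hρdef]; intro h; exact inv_ne_zero hw0 (by linarith)
    have hρroot : Polynomial.aeval ρ Q₀ = 0 := by
      rw [aeval_eq_pow_mul_aeval_revTaylor Q₀ a ρ hρa, hρdef, add_sub_cancel_left, inv_inv, hzero,
        mul_zero]
    have hwW : w = -(-(e : ℝ) * a ^ 2 + 2 * e * a * xs + f * xs + g) /
        (((e : ℝ) * a ^ 2 + f * a + g) * (xs - a)) := by
      rw [hwdef]; push_cast; exact moebius_w_eq e f g a xs hxa hDa'
    have hW : -(e : ℝ) * a ^ 2 + 2 * e * a * xs + f * xs + g ≠ 0 := by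
      intro hW; apply hw0; rw [hwW, hW, neg_zero, zero_div]
    have hρμ : ρ = ((a : ℝ) ^ 2 * (e * xs + f) + 2 * g * a - g * xs) /
        (-(e : ℝ) * a ^ 2 + 2 * e * a * xs + f * xs + g) := by
      rw [hρdef, hwdef]
      push_cast
      exact moebius_mirror_eq e f g a xs hxa hDa' hW
    -- hence `a` is a root of the non-trivial quadratic `P ρ`
    have hPa : (P ρ).eval (a : ℝ) = 0 := by
      rw [hPeval]
      have h := hρμ
      rw [eq_div_iff hW] at h
      linear_combination -h
    rw [hBdef, Finset.mem_biUnion]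
    exact ⟨ρ, hS ρ hρroot, Multiset.mem_toFinset.2 ((Polynomial.mem_roots (hPne ρ hρroot)).2 hPa)⟩
  -- a good centre among `lo − 1 − k`, `k = 0, …, #B`
  by_contra hnone
  push Not at hnone
  have hsub : (Finset.range (B.card + 1)).image (fun k : ℕ => ((lo - 1 - k : ℚ) : ℝ)) ⊆ B := by
    intro t ht
    rw [Finset.mem_image] at ht
    obtain ⟨k, -, rfl⟩ := ht
    have hk : (lo - 1 - k : ℚ) < lo := by
      have : (0 : ℚ) ≤ k := Nat.cast_nonneg k
      linarith
    obtain ⟨hDa, hz⟩ := hnone _ hk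
    exact hbad _ hk hDa hz
  have hinj : Function.Injective (fun k : ℕ => ((lo - 1 - k : ℚ) : ℝ)) := by
    intro k l hkl
    have h : ((lo - 1 - k : ℚ) : ℝ) = ((lo - 1 - l : ℚ) : ℝ) := hkl
    have h' : (k : ℚ) = l := by
      have := (Rat.cast_injective (α := ℝ)) h
      linarith
    exact_mod_cast h'
  have hcard := Finset.card_le_card hsub
  rw [Finset.card_image_of_injective _ hinj, Finset.card_range] at hcard
  omega

/-! #### 24.17 The FULL Euler descent on a clean compact hull -/

/-- GRID SPLITTING: `InBaker [r]` follows from `InBaker` of every restriction of `r` to a cell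
`[p j, p (j+1)]` of a rational grid `p 0 ≤ T ≤ p M` (rule (1a) repeated; a degenerate hull is a
null set). [KontsevichZagier2001 §1.2 rule (1)] -/
theorem InBaker.of_grid (p : ℕ → ℚ) (M : ℕ) (r : KZ.IntegralRep 1)
    (hlo : ∀ v ∈ r.domain, (p 0 : ℝ) ≤ v 0) (hhi : ∀ v ∈ r.domain, v 0 ≤ (p M : ℝ))
    (hcell : ∀ j < M, ∀ r₁ : KZ.IntegralRep 1,
      r₁.domain ⊆ {v | v ∈ r.domain ∧ (p j : ℝ) ≤ v 0 ∧ v 0 ≤ p (j + 1)} →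
      r₁.integrand = r.integrand → InBaker (KZ.of r₁)) :
    InBaker (KZ.of r) := by
  induction M generalizing r with
  | zero =>
    have hsub : r.domain.Subsingleton := by
      intro s hs t ht
      funext j
      fin_cases j
      change s 0 = t 0
      linarith [hlo s hs, hhi s hs, hlo t ht, hhi t ht]
    exact InBaker.of_mem_relations
      (KZ.of_mem_relations_of_volume_eq_zero _ (hsub.measure_zero _))
  | succ M ih =>
    refine InBaker.of_split_at (p M) r (fun r₁ h₁ hi₁ => ?_) (fun r₁ h₁ hi₁ => ?_)
    · exact hcell M (Nat.lt_succ_self M) r₁ (fun v hv => by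
        rw [h₁] at hv; exact ⟨hv.1, hv.2.le, hhi v hv.1⟩) hi₁
    · refine ih r₁ (fun v hv => ?_) (fun v hv => ?_) (fun j hj r₂ h₂ hi₂ => ?_)
      · rw [h₁] at hv; exact hlo v hv.1
      · rw [h₁] at hv; exact hv.2.le
      · refine hcell j (Nat.lt_succ_of_lt hj) r₂ (fun v hv => ?_) (hi₂.trans hi₁)
        have hv' := h₂ hv
        rw [h₁] at hv'
        exact ⟨hv'.1.1, hv'.2⟩

/-- **THE FULL EULER DESCENT (generic part).** `[T, N(x)/Q(x)·√(e x² + f x + g)] ∈ InBaker` for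
`e ≠ 0`, `h ≠ 0`, ANY numerator `N ∈ ℚ[x]` and ANY denominator `Q ∈ ℚ[x]` without zeros on a
compact rational hull `[lo, hi] ⊇ T` and without REAL zeros on the conic `D = 0` — in particular
for every `Q` irreducible over `ℚ` of degree `≥ 2` and coprime to `D` (complex-conjugate and
real-irrational pole pairs of any multiplicity: the case no single Euler chart with rational
coefficients reaches).  PROOF = the dispatcher announced in §24.15: by `exists_moebius_centre`
every point `x⋆` of the hull has a rational centre `a < lo` whose inversion chart is pole-free
near `x⋆`; by continuity this persists on a ball; a Lebesgue number of the cover of `[lo, hi]`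
and a rational grid finer than it cut `T` into finitely many cells (`InBaker.of_grid`), and each
cell is `InBaker.moebius_factor'`.  Rational poles (any multiplicity, `rat_factor_mult`), poles
at rational roots of `D` (`root_pole_atom`) and the factor `D` itself (`inv_sqrt_factor`) are the
complementary special parts, to be split off by partial fractions over `ℚ` first. [this node] -/
theorem InBaker.euler_full (e f g : ℚ) (he : e ≠ 0) (hh : g - f ^ 2 / (4 * e) ≠ 0)
    (N Q : Polynomial ℚ) (lo hi : ℚ)
    (hQ : ∀ x : ℝ, (lo : ℝ) ≤ x → x ≤ hi → Polynomial.aeval x Q ≠ 0)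
    (hQD : ∀ ρ : ℝ, Polynomial.aeval ρ Q = 0 → qD e f g ρ ≠ 0)
    (r : KZ.IntegralRep 1) (hdom : ∀ v ∈ r.domain, (lo : ℝ) ≤ v 0 ∧ v 0 ≤ hi)
    (hr : EqOn r.integrand (fun v => Polynomial.aeval (v 0) N / Polynomial.aeval (v 0) Q *
      √(qD e f g (v 0))) r.domain) :
    InBaker (KZ.of r) := by
  classical
  rcases lt_or_ge hi lo with hhl | hlh
  · -- empty hull
    have hempty : r.domain = ∅ := by
      ext v
      simp only [mem_empty_iff_false, iff_false]
      intro hv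
      have h1 := hdom v hv
      have h2 : (hi : ℝ) < lo := by exact_mod_cast hhl
      linarith [h1.1, h1.2]
    exact InBaker.of_mem_relations
      (KZ.of_mem_relations_of_volume_eq_zero _ (by rw [hempty, measure_empty]))
  have hlh' : (lo : ℝ) ≤ hi := by exact_mod_cast hlh
  have hQ0 : Q ≠ 0 := by
    intro h; apply hQ lo le_rfl hlh'; rw [h, map_zero]
  -- Step 1: every point of `[lo, ∞)` has a good centre, good on a whole ball
  have hloc : ∀ x : ℝ, (lo : ℝ) ≤ x → ∃ a : ℚ, a < lo ∧ ∃ ε : ℝ, 0 < ε ∧ ∀ y : ℝ, dist y x < ε →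
      (e * a ^ 2 + f * a + g ≠ 0 →
        Polynomial.aeval (2 * ((-(2 * e * a + f) / (2 * (e * a ^ 2 + f * a + g)) : ℚ) : ℝ) -
          (y - a)⁻¹) (Polynomial.reflect Q.natDegree (Polynomial.taylor a Q)) ≠ 0) := by
    intro x hx
    obtain ⟨a, ha, hgood⟩ := exists_moebius_centre e f g Q hQ0 hQD x lo hx
    refine ⟨a, ha, ?_⟩
    by_cases hDa : e * a ^ 2 + f * a + g = 0
    · exact ⟨1, one_pos, fun y _ h => absurd hDa h⟩
    have hxa : x ≠ a := by
      have : (a : ℝ) < lo := by exact_mod_cast ha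
      intro h; linarith
    have hcont : ContinuousAt (fun y : ℝ =>
        Polynomial.aeval (2 * ((-(2 * e * a + f) / (2 * (e * a ^ 2 + f * a + g)) : ℚ) : ℝ) -
          (y - a)⁻¹) (Polynomial.reflect Q.natDegree (Polynomial.taylor a Q))) x := by
      have h1 : ContinuousAt (fun y : ℝ =>
          2 * ((-(2 * e * a + f) / (2 * (e * a ^ 2 + f * a + g)) : ℚ) : ℝ) - (y - a)⁻¹) x :=
        continuousAt_const.sub ((continuousAt_id.sub continuousAt_const).inv₀ (sub_ne_zero.2 hxa))
      exact (Polynomial.continuous_aeval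
        (p := Polynomial.reflect Q.natDegree (Polynomial.taylor a Q))).continuousAt.comp h1
    obtain ⟨ε, hε, hball⟩ := Metric.eventually_nhds_iff.1 (hcont.eventually_ne (hgood hDa))
    exact ⟨ε, hε, fun y hy _ => hball hy⟩
  choose! ac hac εc hεc hgoodc using hloc
  -- Step 2: a Lebesgue number of the cover of the compact hull
  obtain ⟨δ, hδ, hleb⟩ := lebesgue_number_lemma_of_metric
    (ι := {x : ℝ // (lo : ℝ) ≤ x}) (c := fun i => Metric.ball i.1 (εc i.1))
    (isCompact_Icc : IsCompact (Icc (lo : ℝ) hi)) (fun i => Metric.isOpen_ball) (by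
      intro x hx
      exact mem_iUnion.2 ⟨⟨x, hx.1⟩, Metric.mem_ball_self (hεc x hx.1)⟩)
  -- Step 3: a rational grid finer than `δ`
  obtain ⟨M, hM⟩ : ∃ M : ℕ, ((hi : ℝ) - lo) / δ < M := exists_nat_gt _
  have hMpos : 0 < (M : ℝ) := lt_of_le_of_lt (div_nonneg (by linarith) hδ.le) hM
  have hM0 : (M : ℝ) ≠ 0 := hMpos.ne'
  have hwδ : ((hi : ℝ) - lo) / M < δ := by
    rw [div_lt_iff₀ hMpos]
    have := (div_lt_iff₀ hδ).1 hM
    linarith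
  have hw0 : 0 ≤ ((hi : ℝ) - lo) / M := div_nonneg (by linarith) hMpos.le
  have hMw : (M : ℝ) * (((hi : ℝ) - lo) / M) = hi - lo := by field_simp
  set p : ℕ → ℚ := fun j => lo + j * ((hi - lo) / M) with hpdef
  have hpj : ∀ j : ℕ, (p j : ℝ) = lo + j * (((hi : ℝ) - lo) / M) := fun j => by
    simp only [hpdef]; push_cast; ring
  have hp_lo : ∀ j : ℕ, (lo : ℝ) ≤ p j := fun j => by
    rw [hpj]; exact le_add_of_nonneg_right (mul_nonneg (Nat.cast_nonneg j) hw0)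
  have hp_hi : ∀ j : ℕ, j ≤ M → (p j : ℝ) ≤ hi := fun j hj => by
    rw [hpj]
    have : (j : ℝ) * (((hi : ℝ) - lo) / M) ≤ M * (((hi : ℝ) - lo) / M) :=
      mul_le_mul_of_nonneg_right (by exact_mod_cast hj) hw0
    linarith
  have hp_succ : ∀ j : ℕ, (p (j + 1) : ℝ) = p j + ((hi : ℝ) - lo) / M := fun j => by
    rw [hpj, hpj]; push_cast; ring
  refine InBaker.of_grid p M r (fun v hv => ?_) (fun v hv => ?_) (fun j hj r₁ h₁ hi₁ => ?_)
  · have : (p 0 : ℝ) = lo := by rw [hpj]; simp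
    rw [this]; exact (hdom v hv).1
  · have : (p M : ℝ) = hi := by rw [hpj]; linarith
    rw [this]; exact (hdom v hv).2
  -- Step 4: one cell
  obtain ⟨⟨x₀, hx₀⟩, hsub⟩ := hleb (p j) ⟨hp_lo j, hp_hi j hj.le⟩
  have ha : ac x₀ < lo := hac x₀ hx₀
  have ha' : (ac x₀ : ℝ) < lo := by exact_mod_cast ha
  have halo : ac x₀ < p j := by
    have : (ac x₀ : ℝ) < p j := lt_of_lt_of_le ha' (hp_lo j)
    exact_mod_cast this
  -- goodness of the centre `ac x₀` on the whole cell
  have hcellgood : ∀ y : ℝ, (p j : ℝ) ≤ y → y ≤ p (j + 1) →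
      Polynomial.aeval y Q ≠ 0 ∧ (e * ac x₀ ^ 2 + f * ac x₀ + g ≠ 0 →
        Polynomial.aeval (2 * ((-(2 * e * ac x₀ + f) / (2 * (e * ac x₀ ^ 2 + f * ac x₀ + g)) :
          ℚ) : ℝ) - (y - ac x₀)⁻¹) (Polynomial.reflect Q.natDegree (Polynomial.taylor (ac x₀) Q))
            ≠ 0) := by
    intro y hy1 hy2
    refine ⟨hQ y ((hp_lo j).trans hy1) (hy2.trans (hp_hi (j + 1) hj)), fun hDa => ?_⟩
    have hyball : y ∈ Metric.ball (p j : ℝ) δ := by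
      rw [Metric.mem_ball, Real.dist_eq, abs_of_nonneg (by linarith)]
      have := hp_succ j
      linarith
    exact hgoodc x₀ hx₀ y (Metric.mem_ball.1 (hsub hyball)) hDa
  refine InBaker.moebius_factor' e f g (ac x₀) he hh N Q hQ0 (p j) (p (j + 1)) halo
    (fun z hz1 hz2 => ?_) r₁ (fun v hv => (h₁ hv).2) (fun v hv => ?_)
  · -- the point `y = a + 1/z` lies in the cell
    have hpa : (0 : ℝ) < p (j + 1) - ac x₀ := by
      have := hp_lo (j + 1); linarith
    have hpa' : (0 : ℝ) < p j - ac x₀ := by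
      have := hp_lo j; linarith
    have hz1' : 1 / ((p (j + 1) : ℝ) - ac x₀) ≤ z := by
      have := hz1; push_cast at this; exact this
    have hz2' : z ≤ 1 / ((p j : ℝ) - ac x₀) := by
      have := hz2; push_cast at this; exact this
    have hzpos : 0 < z := lt_of_lt_of_le (one_div_pos.2 hpa) hz1'
    set y : ℝ := (ac x₀ : ℝ) + z⁻¹ with hydef
    have hya : y ≠ ac x₀ := by
      rw [hydef]; intro h; exact (inv_ne_zero hzpos.ne') (by linarith)
    have hyz : (y - ac x₀)⁻¹ = z := by rw [hydef, add_sub_cancel_left, inv_inv]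
    have hy1 : (p j : ℝ) ≤ y := by
      rw [hydef]
      have : (p j : ℝ) - ac x₀ ≤ z⁻¹ := by
        rw [le_inv_comm₀ hpa' hzpos]; rwa [one_div] at hz2'
      linarith
    have hy2 : y ≤ p (j + 1) := by
      rw [hydef]
      have : z⁻¹ ≤ (p (j + 1) : ℝ) - ac x₀ := by
        rw [inv_le_comm₀ hzpos hpa]; rwa [one_div] at hz1'
      linarith
    obtain ⟨hQy, hgoody⟩ := hcellgood y hy1 hy2
    refine ⟨?_, fun hDa => ?_⟩
    · rw [aeval_eq_pow_mul_aeval_revTaylor Q (ac x₀) y hya, hyz] at hQy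
      exact right_ne_zero_of_mul hQy
    · have := hgoody hDa
      rwa [hyz] at this
  · rw [hi₁]; exact hr (h₁ hv).1

end Summit.KontsevichZagierPeriods.RootDecompWalshStrata.ConicDescent
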